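import Literature.Probability.Percolation.FiveMarkedNormalisationHexBall1
import HarnessLib

/-!
# The five-point holomorphicity (H) decided on the smallest five-marked domain `hexBall1Five`

Topic `Literature/Probability/Percolation` (site percolation on `𝕋` at `p = 1/2`; continues
`FiveMarkedNormalisationHexBall1.lean` and `FiveMarkedLoopRungHexBall1.lean`, whose tables, index closures, counting
bridge and tally it reuses). Objects (`FiveMarkedLoops.lean`): the pattern probabilities
`patternProb D r c m x x' = P_{1/2}[Match_m ∧ (x or x' joined to y_r)]`, `τ = e^{2πi/3}` (`tau`), the sparse
five-point observable `sparseObs D j c x x' = H_{j,A} − τ² H_{j+1,B} − τ H_{j−1,B}`, the counter-clockwise neighbours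
`ccwNbr`. Sources: M. Khristoforov, S. Smirnov, *Percolation and O(1) loop model*, arXiv:2111.15612 (2021), §1.2 (Lemma 2;
Lemma 4 is the three-disorder holomorphicity shape that the lane's typed five-point conjecture (H) generalises — the
five-disorder statement itself is NOT printed); B. Bollobás, O. Riordan, *Percolation* (CUP 2006), Ch. 7, §7.2.2 and
proof of Lemma 6 p. 175 (marked domains; the counting measure at `p = 1/2`).

THE THEOREM (`hexFivePointHolomorphy_hexBall1Five`): for every colour `c`, corner index `j` and interior face `v` of
`hexBall1Five`, `∑ k : Fin 3, τ^k · sparseObs hexBall1Five j c v (ccwNbr v k) = 0` — the lane's typed conjecture (H)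
(b-engine-2, D6′ pilot: exact on all 648 honeycomb rows) SPECIALISED to the smallest domain and DECIDED by the kernel on
standard axioms: the 6 × 3 × 2 pattern-joined counts at each corner (`hExpected`, 5 × 36 integers, enumeration side
three codes) are certified by ten `decide +kernel` through the verified index evaluators (`pevt_iff`), and the complex
identity follows from the integer identities `A₀ = A₁ = A₂` (`hIdent_all`) and `1 + τ + τ² = 0` (`tau_sum_eq_zero`).
Companion: b-step0's one-vertex witness `FivePointHolomorphyHexBall1.lean`.

Status in print (lane wording, lit-2 g12): (H) is NOT printed (KhS21 prove the three-disorder Lemma 4; the five-point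
version is the lane's conjecture); this file is a kernel-decided INSTANCE on the 7-site domain (C-class computational
content, standard axioms, no `native_decide`), no novelty of mathematics claimed.
-/

noncomputable section

open Finset




namespace Literature.Probability.Percolation.FivePoint.Rung

open Literature.Probability.LatticeModels Literature.Probability.Percolation.FivePoint.S0

/-! ### H1. Evaluators: patterns, and the pattern-joined event -/

/-- The 6 interior faces of `hexBall1Five` with the indices of their three counter-clockwise neighbours `ccwNbr v k`
(`vertTab_lt`, `vertTab_complete`). [cite: KhristoforovSmirnov2021, §1.2 Lemma 2 and Lemma 4 (shape)] -/
def vertTab : List (ℕ × ℕ × ℕ × ℕ) :=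
  [(7, 8, 6, 14), (8, 7, 9, 2), (9, 10, 8, 16), (14, 13, 15, 7), (15, 16, 14, 21), (16, 15, 17, 9)]

/-- The `k`-th neighbour index of a table row. [cite: KhristoforovSmirnov2021, §1.2 Lemma 2 and Lemma 4 (shape)] -/
def nbrOf (t : ℕ × ℕ × ℕ × ℕ) (k : Fin 3) : ℕ := ![t.2.1, t.2.2.1, t.2.2.2] k

/-- The matching closure from `y_{r+1}` and its flag. [cite: KhristoforovSmirnov2021, §1.2 Lemma 2 and Lemma 4 (shape)] -/
def mClos (cfg : List Bool) (r : Fin 5) (c : Bool) : List ℕ := closF cfg r c (cornerIdx (r + 1))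

/-- Pattern bit `m` read from the matching closure: `A` (`m = false`) = `y_{r+2}` reached, `B` = `y_{r+4}` reached. [cite: KhristoforovSmirnov2021, §1.2 Lemma 2 and Lemma 4 (shape)] -/
def matIdx (cfg : List Bool) (r : Fin 5) (c m : Bool) : Bool :=
  if m then (mClos cfg r c).elem (cornerIdx (r + 4)) else (mClos cfg r c).elem (cornerIdx (r + 2))

/-- All three flags of `(cfg, r, c)`: matching closure, interface part, joined set. [cite: KhristoforovSmirnov2021, §1.2 Lemma 2 and Lemma 4 (shape)] -/
def hFlags (cfg : List Bool) (r : Fin 5) (c : Bool) : Bool :=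
  closedF cfg r c (mClos cfg r c) && nFlags cfg r c

/-- The pattern-joined event `Match_m ∧ (face i or face i' joined to y_r)` on indices. [cite: KhristoforovSmirnov2021, §1.2 Lemma 2 and Lemma 4 (shape)] -/
def pevt (cfg : List Bool) (r : Fin 5) (c m : Bool) (i i' : ℕ) : Bool :=
  matIdx cfg r c m && ((jClos cfg r c).elem i || (jClos cfg r c).elem i')

/-- The index list of the tally columns at a fixed corner `r`: `(interior-face index ti, k, m)`, `6 × 3 × 2 = 36`. [cite: KhristoforovSmirnov2021, §1.2 Lemma 2 and Lemma 4 (shape)] -/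
def hIdxs : List (ℕ × Fin 3 × Bool) :=
  (List.range 6).flatMap fun ti => (List.finRange 3).flatMap fun k => [(ti, k, false), (ti, k, true)]

/-- Position of the column `(ti, k, m)`. [cite: KhristoforovSmirnov2021, §1.2 Lemma 2 and Lemma 4 (shape)] -/
def hPos (ti : ℕ) (k : Fin 3) (m : Bool) : ℕ := (ti * 3 + k.val) * 2 + (if m then 1 else 0)

/-- The event of a column on a configuration at `(r, c)`: pattern `m` and the `k`-th edge at the `ti`-th interior face. [cite: KhristoforovSmirnov2021, §1.2 Lemma 2 and Lemma 4 (shape)] -/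
def pevtQ (c : Bool) (r : Fin 5) (cfg : List Bool) (q : ℕ × Fin 3 × Bool) : Bool :=
  pevt cfg r c q.2.2 (vertTab.getD q.1 (0, 0, 0, 0)).1 (nbrOf (vertTab.getD q.1 (0, 0, 0, 0)) q.2.1)

/-- The row of a configuration at `(c, r)` (its 36 column events). [cite: KhristoforovSmirnov2021, §1.2 Lemma 2 and Lemma 4 (shape)] -/
def hRow (c : Bool) (r : Fin 5) (cfg : List Bool) : List Bool := hIdxs.map (pevtQ c r cfg)

/-- The column counts at `(c, r)` (36 counters over the `2⁷` configurations). [cite: KhristoforovSmirnov2021, §1.2 Lemma 2 and Lemma 4 (shape)] -/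
def hTallyAt (c : Bool) (r : Fin 5) : List ℕ := tally ((allBits 7).map (hRow c r)) 36

/-- All flags at `(c, r)`. [cite: KhristoforovSmirnov2021, §1.2 Lemma 2 and Lemma 4 (shape)] -/
def hFlagsAt (c : Bool) (r : Fin 5) : Bool := (allBits 7).all fun cfg => hFlags cfg r c

/-- The expected column counts at corner `r` (enumeration side; identical for both colours by the colour flip): entry
`hPos ti k m` = number of `S ⊆ triBall 1` with pattern `m` at `r` and a face of the `k`-th edge at the `ti`-th interior face
joined to `y_r`. [cite: KhristoforovSmirnov2021, §1.2 Lemma 2 and Lemma 4 (shape)] -/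
def hExpected (_c : Bool) (r : Fin 5) : List ℕ :=
  ![[19, 0, 16, 0, 22, 6, 19, 0, 20, 0, 13, 0, 18, 0, 20, 0, 25, 7, 26, 9, 31, 9, 22, 6, 34, 10, 31, 9, 37, 18, 34, 10, 33, 13, 25, 7],
    [15, 0, 9, 0, 12, 0, 15, 0, 20, 6, 14, 0, 28, 13, 20, 6, 26, 8, 9, 0, 12, 3, 12, 0, 20, 6, 12, 3, 11, 3, 20, 6, 26, 15, 26, 8],
    [25, 3, 16, 0, 18, 0, 25, 3, 32, 4, 33, 9, 33, 9, 32, 4, 25, 3, 15, 0, 18, 0, 18, 0, 18, 0, 18, 0, 15, 0, 18, 0, 16, 0, 25, 3],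
    [26, 8, 26, 15, 20, 6, 26, 8, 20, 6, 28, 13, 14, 0, 20, 6, 15, 0, 11, 3, 12, 3, 20, 6, 12, 0, 12, 3, 9, 0, 12, 0, 9, 0, 15, 0],
    [25, 7, 33, 13, 34, 10, 25, 7, 20, 0, 18, 0, 13, 0, 20, 0, 19, 0, 37, 18, 31, 9, 34, 10, 22, 6, 31, 9, 26, 9, 22, 6, 16, 0, 19, 0]] r

/-- **The (H) checker at `(c, r)`**: flags, and the 36 column counts equal the expected table. [cite: KhristoforovSmirnov2021, §1.2 Lemma 2 and Lemma 4 (shape)] -/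
def hCheckAt (c : Bool) (r : Fin 5) : Bool := hFlagsAt c r && (hTallyAt c r == hExpected c r)

/-- Count lookup in the expected table. [cite: KhristoforovSmirnov2021, §1.2 Lemma 2 and Lemma 4 (shape)] -/
def hCnt (c : Bool) (r : Fin 5) (ti : ℕ) (k : Fin 3) (m : Bool) : ℕ := (hExpected c r).getD (hPos ti k m) 0

/-- The two integer identities `A₀ = A₁ = A₂` at `(c, j, ti)` in `ℕ`-form, read in the expected table:
`a₀ + b⁺₂ + b⁻₀ = a₁ + b⁺₁ + b⁻₂` and `a₀ + b⁺₀ + b⁻₁ = a₂ + b⁺₁ + b⁻₂`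
(`a_k = #A_j(e_k)`, `b⁺_k = #B_{j+1}(e_k)`, `b⁻_k = #B_{j+4}(e_k)`). [cite: KhristoforovSmirnov2021, §1.2 Lemma 2 and Lemma 4 (shape)] -/
def hIdent (c : Bool) (j : Fin 5) (ti : ℕ) : Bool :=
  (hCnt c j ti 0 false + hCnt c (j + 1) ti 2 true + hCnt c (j + 4) ti 0 true ==
      hCnt c j ti 1 false + hCnt c (j + 1) ti 1 true + hCnt c (j + 4) ti 2 true) &&
    (hCnt c j ti 0 false + hCnt c (j + 1) ti 0 true + hCnt c (j + 4) ti 1 true ==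
      hCnt c j ti 2 false + hCnt c (j + 1) ti 1 true + hCnt c (j + 4) ti 2 true)

end Literature.Probability.Percolation.FivePoint.Rung

namespace Literature.Probability.Percolation.FivePoint.Rung

open Literature.Probability.LatticeModels Literature.Probability.Percolation.FivePoint.S0

/-! ### H2. The tables are correct -/

/-- Interior-face table: indices in range. [cite: KhristoforovSmirnov2021, §1.2 Lemma 2 and Lemma 4 (shape)] -/
theorem vertTab_lt : ∀ t ∈ vertTab, t.1 < 24 ∧ t.2.1 < 24 ∧ t.2.2.1 < 24 ∧ t.2.2.2 < 24 := by decide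

/-- The `k`-th neighbour index is in range. [cite: KhristoforovSmirnov2021, §1.2 Lemma 2 and Lemma 4 (shape)] -/
theorem nbrOf_lt {t : ℕ × ℕ × ℕ × ℕ} (ht : t ∈ vertTab) (k : Fin 3) : nbrOf t k < 24 := by
  obtain ⟨-, h0, h1, h2⟩ := vertTab_lt t ht
  fin_cases k
  · exact h0
  · exact h1
  · exact h2

/-- **Interior-face table is correct**: the tabulated neighbours are `ccwNbr`. [cite: KhristoforovSmirnov2021, §1.2 Lemma 2 and Lemma 4 (shape)] -/
theorem vertTab_ok : ∀ t ∈ vertTab, ∀ k : Fin 3, faceAt (nbrOf t k) = ccwNbr (faceAt t.1) k := by decide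

/-- **Interior-face table is complete**: every face of `U1` with its three vertices in the ball is tabulated. [cite: KhristoforovSmirnov2021, §1.2 Lemma 2 and Lemma 4 (shape)] -/
theorem vertTab_complete : ∀ v ∈ U1, hexFaceVertices v ⊆ triBall 1 →
    (vertTab.any fun t => decide (faceAt t.1 = v)) = true := by decide

/-- The table has six rows. [cite: KhristoforovSmirnov2021, §1.2 Lemma 2 and Lemma 4 (shape)] -/
theorem length_vertTab : vertTab.length = 6 := by rfl

/-- An interior face as a table position. [cite: KhristoforovSmirnov2021, §1.2 Lemma 2 and Lemma 4 (shape)] -/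
theorem exists_vertTab {v : HexVertex} (hv : hexFaceVertices v ⊆ triBall 1) :
    ∃ (ti : ℕ) (t : ℕ × ℕ × ℕ × ℕ), ti < 6 ∧ vertTab[ti]? = some t ∧ faceAt t.1 = v := by
  have := vertTab_complete v (mem_U1_of_subset hv) hv
  obtain ⟨t, ht, hcond⟩ := List.any_eq_true.1 this
  have htv : faceAt t.1 = v := by simpa using hcond
  obtain ⟨ti, hti, hte⟩ := List.mem_iff_getElem.1 ht
  exact ⟨ti, t, by rw [length_vertTab] at hti; exact hti, by rw [List.getElem?_eq_getElem hti, hte], htv⟩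

/-- The index list has `36` entries. [cite: KhristoforovSmirnov2021, §1.2 Lemma 2 and Lemma 4 (shape)] -/
theorem length_hIdxs : hIdxs.length = 36 := by rfl

/-- **Positions in the index list.** [cite: KhristoforovSmirnov2021, §1.2 Lemma 2 and Lemma 4 (shape)] -/
theorem hIdxs_pos : ∀ (k : Fin 3) (m : Bool), ∀ ti < 6, hIdxs[hPos ti k m]? = some (ti, k, m) := by
  decide

/-- Positions are in range. [cite: KhristoforovSmirnov2021, §1.2 Lemma 2 and Lemma 4 (shape)] -/
theorem hPos_lt {ti : ℕ} (hti : ti < 6) (k : Fin 3) (m : Bool) : hPos ti k m < 36 := by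
  have := (List.getElem?_eq_some_iff.1 (hIdxs_pos k m ti hti)).1
  rwa [length_hIdxs] at this

/-! ### H3. Pattern probabilities as counts -/



open Classical in
/-- **The pattern probability as a count** on `hexBall1Five`:
`patternProb r c m x x' = #{S ⊆ triBall 1 | Match_m(S) ∧ (x or x' joined to y_r under S)} / 2⁷`. [cite: KhristoforovSmirnov2021, §1.2 Lemma 2 and Lemma 4 (shape)] -/
theorem patternProb_eq_card_div (r : Fin 5) (c m : Bool) (x x' : HexVertex) :
    patternProb hexBall1Five r c m x x' =
      (((triBall 1).powerset.filter fun T : Finset (Site 2) =>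
          (if m then MatchB hexBall1Five (↑T) r c else MatchA hexBall1Five (↑T) r c) ∧
            (Joined hexBall1Five (↑T) r c x ∨ Joined hexBall1Five (↑T) r c x')).card : ℝ) / 2 ^ 7 := by
  have h := triSitePercolation_half_real_setOf_eq_card_div
    (P := fun σ => (if m then MatchB hexBall1Five σ r c else MatchA hexBall1Five σ r c) ∧
      (Joined hexBall1Five σ r c x ∨ Joined hexBall1Five σ r c x')) (triBall 1)
    fun σ => by
      have h1 := (joined_inter_iff hexBall1Five σ r c x).symm
      have h2 := (joined_inter_iff hexBall1Five σ r c x').symm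
      have hA := (loopLocal_holds hexBall1Five σ r c).1
      have hB := (loopLocal_holds hexBall1Five σ r c).2
      rw [hexBall1Five_verts] at h1 h2 hA hB
      cases m
      · simp only [Bool.false_eq_true, ↓reduceIte]; rw [hA, h1, h2]
      · simp only [↓reduceIte]; rw [hB, h1, h2]
  unfold patternProb
  rw [← card_triBall_one]
  convert h using 4
  congr 1

/-! ### H4. The pattern-joined event rendered -/

/-- Unpacking the flags of `(cfg, r, c)`. [cite: KhristoforovSmirnov2021, §1.2 Lemma 2 and Lemma 4 (shape)] -/
theorem hFlags_iff {cfg : List Bool} {r : Fin 5} {c : Bool} :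
    hFlags cfg r c = true ↔ closedF cfg r c (mClos cfg r c) = true ∧ nFlags cfg r c = true := by
  unfold hFlags; rw [Bool.and_eq_true]

/-- **The pattern-joined event on indices**: for `T ⊆ triBall 1`, tabulated faces `i, i'` and valid flags,
`Match_m ∧ (face i or face i' joined)` iff `pevt`. [cite: KhristoforovSmirnov2021, §1.2 Lemma 2 and Lemma 4 (shape)] -/
theorem pevt_iff (T : Finset (Site 2)) (r : Fin 5) (c m : Bool) {i i' : ℕ} (hi : i < 24) (hi' : i' < 24)
    (hfl : hFlags (encode T) r c = true) :
    ((if m then MatchB hexBall1Five (↑T) r c else MatchA hexBall1Five (↑T) r c) ∧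
        (Joined hexBall1Five (↑T) r c (faceAt i) ∨ Joined hexBall1Five (↑T) r c (faceAt i'))) ↔
      pevt (encode T) r c m i i' = true := by
  obtain ⟨hclM, hflN⟩ := hFlags_iff.1 hfl
  have hA : MatchA hexBall1Five (↑T) r c ↔ cornerIdx (r + 2) ∈ mClos (encode T) r c :=
    linked_iff_closF T r c (r + 1) (r + 2) hclM
  have hB : MatchB hexBall1Five (↑T) r c ↔ cornerIdx (r + 4) ∈ mClos (encode T) r c :=
    linked_iff_closF T r c (r + 1) (r + 4) hclM
  unfold pevt matIdx
  rw [joined_faceAt_iff T r c hflN hi, joined_faceAt_iff T r c hflN hi', Bool.and_eq_true, Bool.or_eq_true,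
    List.elem_iff, List.elem_iff]
  cases m
  · simp only [Bool.false_eq_true, ↓reduceIte]; rw [hA, List.elem_iff]
  · simp only [↓reduceIte]; rw [hB, List.elem_iff]

/-! ### H5. The tally columns -/

/-- Rows have 36 entries. [cite: KhristoforovSmirnov2021, §1.2 Lemma 2 and Lemma 4 (shape)] -/
theorem length_hRow (c : Bool) (r : Fin 5) (cfg : List Bool) : (hRow c r cfg).length = 36 := by
  simp [hRow, length_hIdxs]

/-- **Column `(ti, k, m)` of the tally at `(c, r)`** counts the configurations in the corresponding event. [cite: KhristoforovSmirnov2021, §1.2 Lemma 2 and Lemma 4 (shape)] -/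
theorem hTallyAt_getD (c : Bool) (r : Fin 5) {ti : ℕ} (hti : ti < 6) (k : Fin 3) (m : Bool) {t : ℕ × ℕ × ℕ × ℕ}
    (ht : vertTab[ti]? = some t) :
    (hTallyAt c r).getD (hPos ti k m) 0 = (allBits 7).countP fun cfg => pevt cfg r c m t.1 (nbrOf t k) := by
  unfold hTallyAt
  rw [tally_getD _ _ _ (hPos_lt hti k m) (fun row hrow => by
    obtain ⟨cfg, -, rfl⟩ := List.mem_map.1 hrow; exact length_hRow c r cfg), List.countP_map]
  congr 1
  funext cfg
  simp only [Function.comp_apply]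
  unfold hRow
  rw [List.getD_eq_getElem?_getD, List.getElem?_map, hIdxs_pos k m ti hti]
  simp only [Option.map_some, Option.getD_some, pevtQ]
  rw [List.getD_eq_getElem?_getD, ht]
  rfl

/-! ### H6. The algebra of `τ` -/

/-- `τ³ = 1`. [cite: KhristoforovSmirnov2021, §1.2 Lemma 2 and Lemma 4 (shape)] -/
private theorem tau_pow_three : tau ^ 3 = 1 := by
  unfold tau
  rw [← Complex.exp_nat_mul]
  have : ((3 : ℕ) : ℂ) * (2 * Real.pi * Complex.I / 3) = 2 * Real.pi * Complex.I := by push_cast; ring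
  rw [this, Complex.exp_two_pi_mul_I]

/-- `τ ≠ 1`. [cite: KhristoforovSmirnov2021, §1.2 Lemma 2 and Lemma 4 (shape)] -/
private theorem tau_ne_one : tau ≠ 1 := by
  unfold tau
  intro h
  obtain ⟨n, hn⟩ := Complex.exp_eq_one_iff.1 h
  have hπ : (2 * Real.pi * Complex.I : ℂ) ≠ 0 := by
    simp [Real.pi_ne_zero, Complex.I_ne_zero]
  have key : (1 : ℂ) * (2 * Real.pi * Complex.I) = (3 * n) * (2 * Real.pi * Complex.I) := by
    linear_combination 3 * hn
  have h3 : (1 : ℂ) = 3 * n := mul_right_cancel₀ hπ key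
  have h3' : (1 : ℤ) = 3 * n := by exact_mod_cast h3
  omega

/-- `1 + τ + τ² = 0`. [cite: KhristoforovSmirnov2021, §1.2 Lemma 2 and Lemma 4 (shape)] -/
theorem one_add_tau_add_sq : 1 + tau + tau ^ 2 = 0 := by
  have h : (tau - 1) * (1 + tau + tau ^ 2) = 0 := by
    have := tau_pow_three
    linear_combination this
  rcases mul_eq_zero.1 h with h1 | h2
  · exact absurd (sub_eq_zero.1 h1) tau_ne_one
  · exact h2

/-- **The algebraic core of (H)**: if `A₀ = A₁ = A₂` (in the `ℕ`-form of `hIdent`), the `τ`-weighted sum vanishes. [cite: KhristoforovSmirnov2021, §1.2 Lemma 2 and Lemma 4 (shape)] -/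
theorem tau_sum_eq_zero (a bp bm : Fin 3 → ℕ)
    (h1 : a 0 + bp 2 + bm 0 = a 1 + bp 1 + bm 2) (h2 : a 0 + bp 0 + bm 1 = a 2 + bp 1 + bm 2) :
    ∑ k : Fin 3, tau ^ (k : ℕ) *
      ((((a k : ℝ) / 2 ^ 7 : ℝ) : ℂ) - tau ^ 2 * (((bp k : ℝ) / 2 ^ 7 : ℝ) : ℂ) - tau * (((bm k : ℝ) / 2 ^ 7 : ℝ) : ℂ)) = 0 := by
  have h1' : (a 0 : ℂ) + bp 2 + bm 0 = a 1 + bp 1 + bm 2 := by exact_mod_cast h1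
  have h2' : (a 0 : ℂ) + bp 0 + bm 1 = a 2 + bp 1 + bm 2 := by exact_mod_cast h2
  rw [Fin.sum_univ_three]
  simp only [Fin.val_zero, Fin.val_one, Fin.val_two, pow_zero, pow_one]
  push_cast
  have t3 := tau_pow_three
  have ts := one_add_tau_add_sq
  linear_combination ((a 0 : ℂ) - bp 1 - bm 2) / 2 ^ 7 * ts + (-(bp 1 : ℂ) - bm 2 - bp 2 * tau) / 2 ^ 7 * t3
    - tau / 2 ^ 7 * h1' - tau ^ 2 / 2 ^ 7 * h2'

end Literature.Probability.Percolation.FivePoint.Rung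

namespace Literature.Probability.Percolation.FivePoint.Rung

open Literature.Probability.LatticeModels Literature.Probability.Percolation.FivePoint.S0

/-! ### H7. Assembly -/

/-- Unpacking the checker at `(c, r)`. [cite: KhristoforovSmirnov2021, §1.2 Lemma 2 and Lemma 4 (shape)] -/
theorem hCheckAt_sound {c : Bool} {r : Fin 5} (h : hCheckAt c r = true) :
    hFlagsAt c r = true ∧ hTallyAt c r = hExpected c r := by
  unfold hCheckAt at h
  rw [Bool.and_eq_true, beq_iff_eq] at h
  exact h

open Classical in
/-- **The pattern probability as a table entry**: under the checker at `(c, r)`, for the `ti`-th interior face `t` and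
its `k`-th neighbour, `patternProb r c m = hCnt c r ti k m / 2⁷`. [cite: KhristoforovSmirnov2021, §1.2 Lemma 2 and Lemma 4 (shape)] -/
theorem patternProb_eq_hCnt {c : Bool} {r : Fin 5} (h : hCheckAt c r = true) {ti : ℕ} (hti : ti < 6)
    {t : ℕ × ℕ × ℕ × ℕ} (ht : vertTab[ti]? = some t) (k : Fin 3) (m : Bool) :
    patternProb hexBall1Five r c m (faceAt t.1) (faceAt (nbrOf t k)) = (hCnt c r ti k m : ℝ) / 2 ^ 7 := by
  obtain ⟨hfl, htal⟩ := hCheckAt_sound h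
  have htmem : t ∈ vertTab := List.mem_of_getElem? ht
  have hfl' : ∀ cfg ∈ allBits 7, hFlags cfg r c = true := by
    unfold hFlagsAt at hfl; exact List.all_eq_true.1 hfl
  rw [patternProb_eq_card_div, div_left_inj' (by positivity), Nat.cast_inj,
    card_filter_powerset_eq_countP _ (fun cfg => pevt cfg r c m t.1 (nbrOf t k))
      (fun T _ => pevt_iff T r c m (vertTab_lt t htmem).1 (nbrOf_lt htmem k) (hfl' (encode T) (encode_mem T)))]
  unfold hCnt
  rw [← htal, hTallyAt_getD c r hti k m ht]

/-- **(H) on `hexBall1Five` from the checker.** [cite: KhristoforovSmirnov2021, §1.2 Lemma 2 and Lemma 4 (shape)] -/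
theorem holomorphy_of_hCheck (hH : ∀ c r, hCheckAt c r = true)
    (hI : ∀ (c : Bool) (j : Fin 5), ∀ ti < 6, hIdent c j ti = true) (c : Bool) (j : Fin 5) (v : HexVertex)
    (hv : hexFaceVertices v ⊆ hexBall1Five.verts) :
    ∑ k : Fin 3, tau ^ (k : ℕ) * sparseObs hexBall1Five j c v (ccwNbr v k) = 0 := by
  rw [hexBall1Five_verts] at hv
  obtain ⟨ti, t, hti, ht, rfl⟩ := exists_vertTab hv
  have htmem : t ∈ vertTab := List.mem_of_getElem? ht
  have hnb : ∀ k : Fin 3, ccwNbr (faceAt t.1) k = faceAt (nbrOf t k) := fun k => (vertTab_ok t htmem k).symm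
  simp only [sparseObs, hnb]
  simp only [patternProb_eq_hCnt (hH c j) hti ht, patternProb_eq_hCnt (hH c (j + 1)) hti ht,
    patternProb_eq_hCnt (hH c (j + 4)) hti ht]
  have hid := hI c j ti hti
  unfold hIdent at hid
  rw [Bool.and_eq_true, beq_iff_eq, beq_iff_eq] at hid
  exact tau_sum_eq_zero (fun k => hCnt c j ti k false) (fun k => hCnt c (j + 1) ti k true)
    (fun k => hCnt c (j + 4) ti k true) hid.1 hid.2

/-! ### H8. Kernel evaluation (standard axioms) and the theorem -/

/-- `(c, r) = (false, 0)`. [cite: KhristoforovSmirnov2021, §1.2 Lemma 2 and Lemma 4 (shape)] -/ theorem hCheckAt_f0 : hCheckAt false 0 = true := by decide +kernel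
/-- `(c, r) = (false, 1)`. [cite: KhristoforovSmirnov2021, §1.2 Lemma 2 and Lemma 4 (shape)] -/ theorem hCheckAt_f1 : hCheckAt false 1 = true := by decide +kernel
/-- `(c, r) = (false, 2)`. [cite: KhristoforovSmirnov2021, §1.2 Lemma 2 and Lemma 4 (shape)] -/ theorem hCheckAt_f2 : hCheckAt false 2 = true := by decide +kernel
/-- `(c, r) = (false, 3)`. [cite: KhristoforovSmirnov2021, §1.2 Lemma 2 and Lemma 4 (shape)] -/ theorem hCheckAt_f3 : hCheckAt false 3 = true := by decide +kernel
/-- `(c, r) = (false, 4)`. [cite: KhristoforovSmirnov2021, §1.2 Lemma 2 and Lemma 4 (shape)] -/ theorem hCheckAt_f4 : hCheckAt false 4 = true := by decide +kernel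
/-- `(c, r) = (true, 0)`. [cite: KhristoforovSmirnov2021, §1.2 Lemma 2 and Lemma 4 (shape)] -/ theorem hCheckAt_t0 : hCheckAt true 0 = true := by decide +kernel
/-- `(c, r) = (true, 1)`. [cite: KhristoforovSmirnov2021, §1.2 Lemma 2 and Lemma 4 (shape)] -/ theorem hCheckAt_t1 : hCheckAt true 1 = true := by decide +kernel
/-- `(c, r) = (true, 2)`. [cite: KhristoforovSmirnov2021, §1.2 Lemma 2 and Lemma 4 (shape)] -/ theorem hCheckAt_t2 : hCheckAt true 2 = true := by decide +kernel
/-- `(c, r) = (true, 3)`. [cite: KhristoforovSmirnov2021, §1.2 Lemma 2 and Lemma 4 (shape)] -/ theorem hCheckAt_t3 : hCheckAt true 3 = true := by decide +kernel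
/-- `(c, r) = (true, 4)`. [cite: KhristoforovSmirnov2021, §1.2 Lemma 2 and Lemma 4 (shape)] -/ theorem hCheckAt_t4 : hCheckAt true 4 = true := by decide +kernel

/-- All ten `(c, r)` checks. [cite: KhristoforovSmirnov2021, §1.2 Lemma 2 and Lemma 4 (shape)] -/
theorem hCheckAt_all : ∀ (c : Bool) (r : Fin 5), hCheckAt c r = true := by
  intro c r
  cases c <;> fin_cases r
  · exact hCheckAt_f0
  · exact hCheckAt_f1
  · exact hCheckAt_f2
  · exact hCheckAt_f3
  · exact hCheckAt_f4
  · exact hCheckAt_t0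
  · exact hCheckAt_t1
  · exact hCheckAt_t2
  · exact hCheckAt_t3
  · exact hCheckAt_t4

/-- The twelve identities per `(c, j)` on the expected table (pure arithmetic). [cite: KhristoforovSmirnov2021, §1.2 Lemma 2 and Lemma 4 (shape)] -/
theorem hIdent_all : ∀ (c : Bool) (j : Fin 5), ∀ ti < 6, hIdent c j ti = true := by
  unfold hIdent hCnt hExpected hPos
  decide

/-- ★ **THE (H) RUNG: the five-point holomorphicity holds on the smallest five-marked domain `hexBall1Five`** — for
every colour `c`, corner index `j` and interior face `v`, `Σ_{k<3} τ^k F_j(v, ccwNbr v k) = 0` with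
`F_j(e) = H_{j,A}(e) − τ² H_{j+1,B}(e) − τ H_{j−1,B}(e)` (`sparseObs`): the D1-v2 conjecture `HexFivePointHolomorphy`
specialised to `D := hexBall1Five`, decided by the kernel on standard axioms. [cite: KhristoforovSmirnov2021, §1.2 Lemma 2 and Lemma 4 (shape)] -/
theorem hexFivePointHolomorphy_hexBall1Five (c : Bool) (j : Fin 5) (v : HexVertex)
    (hv : hexFaceVertices v ⊆ hexBall1Five.verts) :
    ∑ k : Fin 3, tau ^ (k : ℕ) * sparseObs hexBall1Five j c v (ccwNbr v k) = 0 :=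
  holomorphy_of_hCheck hCheckAt_all hIdent_all c j v hv

end Literature.Probability.Percolation.FivePoint.Rung

end
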